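import Literature.MathematicalPhysics.QuantumFieldTheory.Balaban1983to89.Beta.RemainderDecay190Dictionary

/-!
# [Balaban1987RG1] (4.4) p. 281 ∕ p. 282 ↔ [Balaban1985Variational] (190): the LAST (T12) dictionary letter `hdom` of the
# (190)-socket `Data190` DISCHARGED by fixing the (4.4)-space MODEL — sup-normed lattice fields restricted to X̄
# (`Beta.RemainderDecay190SupNorm`)

statement-level skeleton of published theorems with citation tags; proofs where landed; nothing here is a claim
about the Yang–Mills mass gap.

HONEST FRAMING (cell rule).  Bookkeeping for the k-uniform remainder chain of row (D4) (`RemainderConst` ⇐ ONE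
`ChainTFac190` instance, `Beta.RemainderDecay190`); discharges NOTHING of `BetaPertH`; NOT B12 Thm 2, NOT the continuum
limit, NOT Clay.  Unit `b2b-balaban-beta-an4` gen 94 (BINDER row D4 OWNER; cell pub-balaban).  Imports
`Beta.RemainderDecay190Dictionary` (gen 93) ONLY; nothing edited.

WHAT.  Of the three (4.4)-dictionary letters of `RemainderDecay190.Data190 d M N Wn q` (owner table
`HOME/b2b-balaban-beta-an4/D4-INSTANCE-LINKS.md` §3, tag NOT-IN-PRINT (T12)), generation 93 proved `hm` and `hD` on the
cube-torus block carrier and left `hdom` — *domination of the (4.4)-norm of X̄ by the local sizes over the blocks meeting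
X̄* (`B12Decay510FromB11.NormDominated`; cell DIVERGENCE D-b03.12 (ii): *"the (4.4) functional is a max of four sup-type
seminorms of the restriction to X, each bounded by block local sizes up to the dictionary between the two papers' norms,
which the print leaves to the reader"*) — a hypothesis, because it quantifies over the (4.4)-space `Wn n` (NODE B's
choice).  THIS FILE FIXES THE MODEL OF THE (4.4)-SPACE and proves `hdom` there:
* §1 (any carrier) `normDominated_pi_of_coord` — THE COORDINATE READING of (4.4): if the (4.4)-space is a finite
  product `J → E` with the sup norm and every coordinate of `ι_X A` either vanishes or is bounded by some local size
  `(bout i).loc y A` over a block `y ∈ blk X̄`, then `NormDominated bout blk ι`.  This is the shape of the printed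
  functional *"max{∣𝐀∣_X, ∣P₁(□₀)𝐀∣_X, ∣∇^ξ𝐀∣_X, ∣Δ^ξ𝐀∣_X}"* (four sup-sizes over X; J = the four sizes × the bonds ∕ sites,
  coordinates = the local linear read-outs) and of the cell's carrier of record for the (4.4)-SET
  (`B12Eq44Space.space44 ⊆ (PBond P i → 𝔸)`, sup norm, unit lit-balaban-p05).
* §2 (the site-scalar model on the fine torus `TPt d (N·M)`) the identification
  `ι_X̄ A := (x ↦ if cube x ∈ X̄ then (A x : ℂ) else 0)` — the configuration RESTRICTED TO X̄ and complexified, read in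
  `Wn := TPt d (N·M) → ℂ` with the sup norm: `norm_restrictC_le_iff` (‖ι_X̄ A‖ ≤ t ↔ ∣A x∣ ≤ t on the cubes of X̄ — the
  literal *"sup over X"*), `restrictC_add` ∕ `restrictC_smul` (ℝ-linear), `normDominated_restrictC` (`hdom` for ANY
  family of local sizes one of which sees the site values on the blocks `e(cube x)`), `norm_restrictC_le_supLoc` (the
  model is pv12's literal *"max over the blocks meeting X̄"* reading `supLoc`), `normDominated_restrictC_ofBlocks`
  (`hdom` for the sharp block sizes of the block map `e ∘ cube` — NO LETTER LEFT).
* §3 `exists_data190_of_sectG_blocks_supNorm` — generation 93's JOIN CERTIFICATE with `hdom` FILLED as well: on the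
  block carrier (block torus `UT (Nf n)`, non-shrinking block-index maps `e n`, B-data AND configurations = real functions
  on the fine torus with the sharp block sizes of `e n ∘ cube`, (4.4)-space = the sup-normed complex fields, δ source
  fields) the (190)-socket `Data190 d M N (fun n => TPt d (N n·M) → ℂ) q` is INHABITED from the per-torus Sect. G
  letters of [15] ((182), (184), (188), (189), the majorants of G̃, Δ, 𝐇₀, 𝐇_k, the free derivative) and numerics ALONE —
  ZERO dictionary letters — stated as an EXISTENCE WITH THE (4.35) COMPUTATION RULE EXPOSED: the socket's test vector
  `D.hn n X̄ x` IS the column at x of the kernel of δ𝐇_j∕δB restricted to the cubes of X̄ (`x′ ↦ (δ𝐇∕δB)(δ_x)(x′)` there,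
  0 elsewhere), so NODE E's (1.21) junction (`Gaps.D4NodeEConvergence.hconv_of_periodisedColumns`, `hid`) reads on the
  model ENTRYWISE with `V Y := ι → ℂ`, `r n Y := RemainderLocalitySockets.restrictCLM (N n·M) (e Y)` and `Φ Y := id`;
  `exists_data190_of_sectG_cubes_supNorm` the same with the canonical identification ê of the cube torus (no block-index
  letter either).
CONVENTION FIXED HERE (the (T12) item, owner's ruling for THIS carrier, completing generation 93's): the (4.4)-space of
X̄ is modelled by the complex lattice fields with the sup norm, a real configuration being read in it by restriction to
the cubes of X̄; the (4.4)-sizes are the sharp block sup-sizes.  For Bałaban's own (4.4)-space (four weighted sup-sizes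
of 𝔤ᶜ-valued bond fields, [I] p. 281) §1 is the reading; the instance is NODE O ∕ NODE B's and nothing of it is asserted.
WHAT IS *NOT* DONE: no operator of Bałaban's is constructed (the Sect. G letters remain hypotheses on abstract linear
maps); row D4 class UNCHANGED (instance 0∕1; critical-path width 0 = NODE O; D4 DISCHARGE NO DATE).  No `def`, no named
fact, no `sorry`, standard axioms.
HONEST DEPENDENCY: continuum YM on T⁴ ⇐ BetaPertH ∧ nine spine estimates (0/9 proved); BetaPertH ⇐ (D1) ∧ (D4) ∧
CAP+tail; G-an2-4 gates asym, D1 and NE2/3/4.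

Sources: [I] = T. Bałaban, *Renormalization group approach to lattice gauge field theories. I*, Commun. Math. Phys.
**109** (1987) 249–301 [Balaban1987RG1], (4.4) p. 281 (*"the space of configurations 𝐀 satisfying max{∣𝐀∣_X,
∣P₁(□₀)𝐀∣_X, ∣∇^ξ𝐀∣_X, ∣Δ^ξ𝐀∣_X} < α₂"*), p. 282 (*"can be estimated by B₃∏∣B_i∣"*), (4.35) p. 290; [15] = *The variational
problem and background fields in renormalization group method for lattice gauge theories*, Commun. Math. Phys. **102**
(1985) 277–309 [Balaban1985Variational], (190) p. 308 (*"for x ∈ Δ(y)"* — block by block); [3] = *Propagators and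
renormalization transformations for lattice gauge theories. II*, Commun. Math. Phys. **96** (1984) 223–250
[Balaban1984PropagatorsII], (2.46) p. 231, Lemma 2.1 (2.61) p. 234.
-/

namespace Literature.MathematicalPhysics.QuantumFieldTheory.Balaban1983to89.Beta.RemainderDecay190SupNorm

open Literature.MathematicalPhysics.QuantumFieldTheory.Balaban1983to89 B11SectG B6RandomWalk
open Literature.MathematicalPhysics.QuantumFieldTheory.Balaban1983to89.B9Thm34Ext (toB6)
open Literature.MathematicalPhysics.QuantumFieldTheory.Balaban1983to89.B9Thm37GlueTorus (torusGeom tdist1)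
open Literature.MathematicalPhysics.QuantumFieldTheory.Balaban1983to89.B5TorusCover (UT)
open Literature.MathematicalPhysics.QuantumFieldTheory.Balaban1983to89.TreeLengthTorus (TPt TDom tsys)
open Literature.MathematicalPhysics.QuantumFieldTheory.Balaban1983to89.B12Decay510Torus (pl1 tcubeOf)
open Literature.MathematicalPhysics.QuantumFieldTheory.Balaban1983to89.B12Decay510FromB11 (NormDominated supLoc loc_le_supLoc)
open Literature.MathematicalPhysics.QuantumFieldTheory.Balaban1983to89.B11AxialTransport190 (abs_le_loc_ofBlocks)
open Literature.MathematicalPhysics.QuantumFieldTheory.Balaban1983to89.Beta.RemainderDecay190 (Data190 Consts190)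
open Literature.MathematicalPhysics.QuantumFieldTheory.Balaban1983to89.Beta.RemainderDecay190SectGTorus
  (h190_of_sectG_torusGeom hdist_torusGeom)
open Literature.MathematicalPhysics.QuantumFieldTheory.Balaban1983to89.Beta.RemainderRowSum (hrow_torusGeom)
open Literature.MathematicalPhysics.QuantumFieldTheory.Balaban1983to89.Beta.RemainderDecay190Dictionary
  (pl1_le_tdist1_finOfVal loc_ofBlocks_single_le_one unitFieldsLocalised_single)

/-! ## 1. Any carrier: the COORDINATE READING of the (4.4)-functional -/

section Coord

variable {g : B6.Geometry} {FA : Type} [AddCommGroup FA] [Module ℝ FA] {S : LocDomainSys} {I : Type*}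
  {J : Type*} [Fintype J] {E : Type*} [SeminormedAddCommGroup E]

/-- **THE COORDINATE READING OF (4.4)**: let the (4.4)-space be a finite product `J → E` with the sup norm (J = the
sizes entering (4.4) × the bonds ∕ sites; e.g. the carrier `PBond P i → 𝔸` of `B12Eq44Space.space44`) and let the
identification `ι_X A` of a real configuration have, at every coordinate j, either the value 0 (j is not read inside X)
or a value bounded in norm by some local size `(bout i).loc y A` over a block y of 𝔅 meeting X ([15] (190) bounds the
local quantities *"for x ∈ Δ(y)"*, block by block).  Then the (4.4)-norm of X is dominated by the local sizes over the
blocks meeting X (`NormDominated`). [cite: Balaban1987RG1, (4.4) p.281; Balaban1985Variational, (190) p.308] -/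
theorem normDominated_pi_of_coord (bout : I → BlockNorm g FA) (blk : S.Dom → Finset g.Site)
    (ι : S.Dom → FA → (J → E))
    (hι : ∀ X A j, ι X A j = 0 ∨ ∃ i, ∃ y ∈ blk X, ‖ι X A j‖ ≤ (bout i).loc y A) :
    NormDominated bout blk (V := fun _ => J → E) ι := by
  intro X A t ht h
  rw [pi_norm_le_iff_of_nonneg ht]
  intro j
  rcases hι X A j with h0 | ⟨i, y, hy, hle⟩
  · rw [h0, norm_zero]; exact ht
  · exact hle.trans (h i y hy)

/-- The same with the coordinates READ INSIDE X singled out by a predicate: coordinates outside vanish, coordinates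
inside are dominated. [cite: Balaban1987RG1, (4.4) p.281; Balaban1985Variational, (190) p.308] -/
theorem normDominated_pi_of_coord' (bout : I → BlockNorm g FA) (blk : S.Dom → Finset g.Site)
    (ι : S.Dom → FA → (J → E)) (inX : S.Dom → J → Prop)
    (hout : ∀ X A j, ¬ inX X j → ι X A j = 0)
    (hin : ∀ X j, inX X j → ∃ i, ∃ y ∈ blk X, ∀ A, ‖ι X A j‖ ≤ (bout i).loc y A) :
    NormDominated bout blk (V := fun _ => J → E) ι := by
  refine normDominated_pi_of_coord bout blk ι fun X A j => ?_
  by_cases hj : inX X j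
  · obtain ⟨i, y, hy, hle⟩ := hin X j hj
    exact Or.inr ⟨i, y, hy, hle A⟩
  · exact Or.inl (hout X A j hj)

end Coord

/-! ## 2. The site-scalar MODEL on the fine torus: restriction to the cubes of X̄, complexified, sup norm -/

section Restrict

variable {d Nc Mc : ℕ} [NeZero Nc] [NeZero Mc] {g : B6.Geometry} [DecidableEq g.Site] {I : Type*}

/-- **THE MODEL IDENTIFICATION IS THE LITERAL "sup over X̄"**: for t ≥ 0, the sup norm of
`x ↦ (cube x ∈ X̄ ? (A x : ℂ) : 0)` is ≤ t iff ∣A x∣ ≤ t at every site x of a cube of X̄. [cite: Balaban1987RG1, (4.4) p.281] -/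
theorem norm_restrictC_le_iff (X : TDom d Nc) (A : TPt d (Nc * Mc) → ℝ) {t : ℝ} (ht : 0 ≤ t) :
    ‖(fun x : TPt d (Nc * Mc) => if tcubeOf Nc Mc x ∈ X.1 then ((A x : ℝ) : ℂ) else 0)‖ ≤ t ↔
      ∀ x : TPt d (Nc * Mc), tcubeOf Nc Mc x ∈ X.1 → |A x| ≤ t := by
  rw [pi_norm_le_iff_of_nonneg ht]
  refine ⟨fun h x hx => ?_, fun h x => ?_⟩
  · have := h x
    rwa [if_pos hx, Complex.norm_real, Real.norm_eq_abs] at this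
  · by_cases hx : tcubeOf Nc Mc x ∈ X.1
    · rw [if_pos hx, Complex.norm_real, Real.norm_eq_abs]; exact h x hx
    · rw [if_neg hx, norm_zero]; exact ht

/-- The model identification is additive in the configuration. [folklore] [cite: Balaban1987RG1, (4.4) p.281] -/
theorem restrictC_add (X : TDom d Nc) (A A' : TPt d (Nc * Mc) → ℝ) :
    (fun x : TPt d (Nc * Mc) => if tcubeOf Nc Mc x ∈ X.1 then (((A + A') x : ℝ) : ℂ) else 0) =
      (fun x => if tcubeOf Nc Mc x ∈ X.1 then ((A x : ℝ) : ℂ) else 0) +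
        fun x => if tcubeOf Nc Mc x ∈ X.1 then ((A' x : ℝ) : ℂ) else 0 := by
  funext x
  by_cases hx : tcubeOf Nc Mc x ∈ X.1 <;> simp [hx]

/-- The model identification is ℝ-homogeneous in the configuration. [folklore] [cite: Balaban1987RG1, (4.4) p.281] -/
theorem restrictC_smul (X : TDom d Nc) (c : ℝ) (A : TPt d (Nc * Mc) → ℝ) :
    (fun x : TPt d (Nc * Mc) => if tcubeOf Nc Mc x ∈ X.1 then (((c • A) x : ℝ) : ℂ) else 0) =
      (c : ℂ) • fun x => if tcubeOf Nc Mc x ∈ X.1 then ((A x : ℝ) : ℂ) else 0 := by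
  funext x
  by_cases hx : tcubeOf Nc Mc x ∈ X.1 <;> simp [hx]

/-- **`Data190.hdom` IN THE MODEL, for any family of local sizes one of which sees the site values**: blocks of 𝔅
indexed through a map `e` on the cube torus (block of the site x = `e (cube x)`), blocks meeting X̄ := `e''(cubes of
X̄)`; if some size `bout i₀` satisfies `∣A x∣ ≤ (bout i₀).loc (e (cube x)) A`, then the sup norm of the restriction of A
to X̄ is dominated by the local sizes over the blocks meeting X̄ — §1 with the coordinates inside X̄ = the sites of its
cubes. [cite: Balaban1987RG1, (4.4) p.281 and p.282; Balaban1985Variational, (190) p.308] -/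
theorem normDominated_restrictC (e : TPt d Nc → g.Site) (bout : I → BlockNorm g (TPt d (Nc * Mc) → ℝ)) (i₀ : I)
    (hb : ∀ (A : TPt d (Nc * Mc) → ℝ) (x : TPt d (Nc * Mc)), |A x| ≤ (bout i₀).loc (e (tcubeOf Nc Mc x)) A) :
    NormDominated (S := tsys d Nc) bout (fun X : TDom d Nc => (X.1.image e : Finset g.Site))
      (V := fun _ => TPt d (Nc * Mc) → ℂ)
      (fun (X : TDom d Nc) (A : TPt d (Nc * Mc) → ℝ) (x : TPt d (Nc * Mc)) =>
        if tcubeOf Nc Mc x ∈ X.1 then ((A x : ℝ) : ℂ) else 0) := by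
  refine normDominated_pi_of_coord' (S := tsys d Nc) bout (fun X : TDom d Nc => (X.1.image e : Finset g.Site)) _
    (fun X x => tcubeOf Nc Mc x ∈ X.1) (fun X A x hx => if_neg hx) fun X x hx => ?_
  refine ⟨i₀, e (tcubeOf Nc Mc x), Finset.mem_image_of_mem e hx, fun A => ?_⟩
  rw [if_pos hx, Complex.norm_real, Real.norm_eq_abs]
  exact hb A x

/-- **THE MODEL IS pv12's LITERAL "max over the blocks meeting X̄" READING** (`B12Decay510FromB11.supLoc`): for a finite
family of local sizes one of which sees the site values on the blocks `e(cube x)`, the sup norm of the restriction of A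
to X̄ is ≤ max_{i, y ∈ e''(cubes X̄)} loc^i_y(A). [cite: Balaban1987RG1, (4.4) p.281; Balaban1985Variational, (190) p.308] -/
theorem norm_restrictC_le_supLoc [Fintype I] (e : TPt d Nc → g.Site) (bout : I → BlockNorm g (TPt d (Nc * Mc) → ℝ))
    (i₀ : I) (hb : ∀ (A : TPt d (Nc * Mc) → ℝ) (x : TPt d (Nc * Mc)), |A x| ≤ (bout i₀).loc (e (tcubeOf Nc Mc x)) A)
    (X : TDom d Nc) (A : TPt d (Nc * Mc) → ℝ) :
    ‖(fun x : TPt d (Nc * Mc) => if tcubeOf Nc Mc x ∈ X.1 then ((A x : ℝ) : ℂ) else 0)‖ ≤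
      supLoc bout (X.1.image e : Finset g.Site) A := by
  have h0 : 0 ≤ supLoc bout (X.1.image e : Finset g.Site) A := by
    unfold B12Decay510FromB11.supLoc
    exact NNReal.coe_nonneg _
  rw [norm_restrictC_le_iff X A h0]
  intro x hx
  exact (hb A x).trans (loc_le_supLoc bout _ A i₀ (Finset.mem_image_of_mem e hx))

/-- **`Data190.hdom` IN THE MODEL WITH THE SHARP BLOCK SIZES — NO LETTER LEFT**: every size of the family being the
sharp block sup-size `BlockNorm.ofBlocks g (e ∘ cube)` (∣A x∣ ≤ sup over the block of x,
`B11AxialTransport190.abs_le_loc_ofBlocks`), the restriction-to-X̄ identification into the sup-normed complex fields is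
dominated (I inhabited by `i₀`). [cite: Balaban1987RG1, (4.4) p.281 and p.282; Balaban1985Variational, (190) p.308] -/
theorem normDominated_restrictC_ofBlocks (e : TPt d Nc → g.Site) (i₀ : I) :
    NormDominated (S := tsys d Nc) (fun _ : I => BlockNorm.ofBlocks g fun x : TPt d (Nc * Mc) => e (tcubeOf Nc Mc x))
      (fun X : TDom d Nc => (X.1.image e : Finset g.Site)) (V := fun _ => TPt d (Nc * Mc) → ℂ)
      (fun (X : TDom d Nc) (A : TPt d (Nc * Mc) → ℝ) (x : TPt d (Nc * Mc)) =>
        if tcubeOf Nc Mc x ∈ X.1 then ((A x : ℝ) : ℂ) else 0) :=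
  normDominated_restrictC e _ i₀ fun A x =>
    abs_le_loc_ofBlocks (fun z : TPt d (Nc * Mc) => e (tcubeOf Nc Mc z)) A (rfl : e (tcubeOf Nc Mc x) = _)

end Restrict

/-! ## 3. JOIN CERTIFICATE on the block carrier with the (4.4)-space MODEL: ZERO dictionary letters -/

section Certificate

variable {ν : ℕ} {Nf : ℕ → Fin ν → ℕ} [∀ n i, NeZero (Nf n i)] {η L Mg R : ℕ → ℝ} {H : ℕ → Prop}
variable {d Mc : ℕ} [NeZero Mc] {N : ℕ → ℕ} [∀ n, NeZero (N n)] {q : Consts190} {F3 : ℕ → Type}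
  [∀ n, AddCommGroup (F3 n)] [∀ n, Module ℝ (F3 n)]

/-- **JOIN CERTIFICATE, ALL THREE (T12) LETTERS DISCHARGED** — generation 93's
`RemainderDecay190Dictionary.nonempty_data190_of_sectG_blocks_single` with the (4.4)-space FIXED to the model of §2:
per step n, block torus `UT (Nf n)` (d₁ = `tdist1`), a non-shrinking block-index map `e n` (`he`), B-data AND
configurations := real functions on the fine torus `TPt d (N n·M)` with the sharp block sizes of `e n ∘ cube` (so the
(4.4)-sizes `boutn n i`, i ∈ I, are all that size and the B11-side letters for them are stated once), (4.4)-space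
`Wn n := TPt d (N n·M) → ℂ` (sup norm), identification = restriction to the cubes of X̄ complexified, blocks meeting X̄ :=
`(e n)''(cubes of X̄)`, source fields δ_x; the (4.35) test vector `D.hn n X̄ x` of the witness is, BY `rfl`, the column at x
of the kernel of `dH n` restricted to the cubes of X̄ (exposed in the statement for NODE E's entrywise junction).  INPUTS: the configuration-side size `bN n` of (186)∕(189) (cutting constant
≤ κN) and the size `b3 n` on the auxiliary space with the per-torus Sect. G letters of [15] exactly as in generations
91–93 — majorants of G̃ (`hG`, `hG₂`), (189) `h189`, majorants of Δ²𝐇₀ ∕ 𝐇₀ ∕ 𝐇_k ∕ the free derivative (`hD2H0`, `hH0`,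
`hH0₂`, `hH₂`, `hDfr`), the identities (184) `h184`, (182) `h182`, the bound (188) `h188`, the numerics `hq`, `hCst`,
`hδ15`, `0 < q.σ ≤ ⅛δ₀`, `c₀(q.σ∕δ₀)^ν ≤ q.cR`, `1 ≤ q.κB`, `1 ≤ q.m`, `0 ≤ q.θ`, `q.θ·M ≤ 1`.  OUTPUT:
`∃ D : Data190 d M N (fun n => TPt d (N n·M) → ℂ) q` with `D.hn n X̄ x = (x′ ↦ cube x′ ∈ X̄ ? ((dH n δ_x) x′ : ℂ) : 0)` — NO
dictionary letter (`hdom` §2, `hm` ∕ `hD` generation 93).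
Nothing of Bałaban's is constructed: the operators and `bN`, `b3`, `e` are parameters (NODE O).
[cite: Balaban1985Variational, (182)-(190) pp.307-308; Balaban1987RG1, (4.4) p.281 and p.282; Balaban1984PropagatorsII, (2.46) p.231, (2.61) p.234] -/
theorem exists_data190_of_sectG_blocks_supNorm (I : Type) (i₀ : I)
    (e : (n : ℕ) → TPt d (N n) → UT (Nf n))
    (he : ∀ n (a b : TPt d (N n)), pl1 (a - b) ≤ tdist1 (Nf n) (e n a) (e n b))
    (bN : (n : ℕ) → BlockNorm (toB6 (torusGeom (Nf n) (η n) (L n) (Mg n)) (R n) (H n)) (TPt d (N n * Mc) → ℝ))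
    (b3 : (n : ℕ) → BlockNorm (toB6 (torusGeom (Nf n) (η n) (L n) (Mg n)) (R n) (H n)) (F3 n))
    (Gt : (n : ℕ) → F3 n →ₗ[ℝ] (TPt d (N n * Mc) → ℝ)) (W : (n : ℕ) → (TPt d (N n * Mc) → ℝ) →ₗ[ℝ] F3 n)
    (D2H0 : (n : ℕ) → (TPt d (N n * Mc) → ℝ) →ₗ[ℝ] F3 n)
    (H0 Hk A0 dH : (n : ℕ) → (TPt d (N n * Mc) → ℝ) →ₗ[ℝ] (TPt d (N n * Mc) → ℝ))
    (Dfr : (n : ℕ) → (TPt d (N n * Mc) → ℝ) →ₗ[ℝ] (TPt d (N n * Mc) → ℝ)) (M₀ : ℕ → ℝ)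
    {δ₀ BG BG₂ θW cΔ A₀ A₀₂ AH₂ θD κN κ₃ : ℝ}
    (hδ₀ : 0 < δ₀) (hσ₀ : 0 < q.σ) (hσ : q.σ ≤ δ₀ / 8) (hcR : B6.c0 δ₀ (q.σ / δ₀) ^ ν ≤ q.cR)
    (hBG : 0 ≤ BG) (hBG₂ : 0 ≤ BG₂) (hθW : 0 ≤ θW) (hcΔ : 0 ≤ cΔ) (hA₀ : 0 ≤ A₀) (hA₀₂ : 0 ≤ A₀₂)
    (hAH₂ : 0 ≤ AH₂) (hθD : 0 ≤ θD) (hM₀ : ∀ n, 0 ≤ M₀ n)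
    (hκB : 1 ≤ q.κB) (hκN : ∀ n, (bN n).κ ≤ κN) (hκ₃ : ∀ n, (b3 n).κ ≤ κ₃)
    (hG : ∀ n, HasMaj (b3 n) (bN n) (Gt n) (fun y y' => BG * Real.exp (-(δ₀ * tdist1 (Nf n) y y'))))
    (hG₂ : ∀ n, HasMaj (b3 n) (BlockNorm.ofBlocks (toB6 (torusGeom (Nf n) (η n) (L n) (Mg n)) (R n) (H n))
      (fun x : TPt d (N n * Mc) => e n (tcubeOf (N n) Mc x))) (Gt n)
      (fun y y' => BG₂ * Real.exp (-(δ₀ * tdist1 (Nf n) y y'))))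
    (h189 : ∀ n, Ineq189 (bN n) (b3 n) (W n) θW δ₀)
    (hD2H0 : ∀ n, HasMaj (BlockNorm.ofBlocks (toB6 (torusGeom (Nf n) (η n) (L n) (Mg n)) (R n) (H n))
      (fun x : TPt d (N n * Mc) => e n (tcubeOf (N n) Mc x))) (b3 n) (D2H0 n)
      (fun y y' => cΔ * Real.exp (-(δ₀ * tdist1 (Nf n) y y'))))
    (hH0 : ∀ n, HasMaj (BlockNorm.ofBlocks (toB6 (torusGeom (Nf n) (η n) (L n) (Mg n)) (R n) (H n))
      (fun x : TPt d (N n * Mc) => e n (tcubeOf (N n) Mc x))) (bN n) (H0 n)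
      (fun y y' => A₀ * Real.exp (-(δ₀ * tdist1 (Nf n) y y'))))
    (hH0₂ : ∀ n, HasMaj (BlockNorm.ofBlocks (toB6 (torusGeom (Nf n) (η n) (L n) (Mg n)) (R n) (H n))
      (fun x : TPt d (N n * Mc) => e n (tcubeOf (N n) Mc x)))
      (BlockNorm.ofBlocks (toB6 (torusGeom (Nf n) (η n) (L n) (Mg n)) (R n) (H n))
      (fun x : TPt d (N n * Mc) => e n (tcubeOf (N n) Mc x))) (H0 n)
      (fun y y' => A₀₂ * Real.exp (-(δ₀ * tdist1 (Nf n) y y'))))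
    (hH₂ : ∀ n, HasMaj (BlockNorm.ofBlocks (toB6 (torusGeom (Nf n) (η n) (L n) (Mg n)) (R n) (H n))
      (fun x : TPt d (N n * Mc) => e n (tcubeOf (N n) Mc x)))
      (BlockNorm.ofBlocks (toB6 (torusGeom (Nf n) (η n) (L n) (Mg n)) (R n) (H n))
      (fun x : TPt d (N n * Mc) => e n (tcubeOf (N n) Mc x))) (Hk n)
      (fun y y' => AH₂ * Real.exp (-(δ₀ / 2 * tdist1 (Nf n) y y'))))
    (hDfr : ∀ n, HasMaj (bN n) (BlockNorm.ofBlocks (toB6 (torusGeom (Nf n) (η n) (L n) (Mg n)) (R n) (H n))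
      (fun x : TPt d (N n * Mc) => e n (tcubeOf (N n) Mc x))) (Dfr n)
      (fun y y' => θD * Real.exp (-(δ₀ / 2 * tdist1 (Nf n) y y'))))
    (h184 : ∀ n, Eq184 (A0 n) (H0 n) (Gt n) (W n) (D2H0 n))
    (h188 : ∀ n, Bound188 (BlockNorm.ofBlocks (toB6 (torusGeom (Nf n) (η n) (L n) (Mg n)) (R n) (H n))
      (fun x : TPt d (N n * Mc) => e n (tcubeOf (N n) Mc x))) (bN n) (A0 n) (M₀ n))
    (h182 : ∀ n, Eq182 (dH n) (A0 n) (H0 n) (Hk n) (Dfr n))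
    (hq : qG κ₃ κN BG θW q.cR < 1)
    (hCst : (κ₃ * BG₂ * (cΔ + κN * θW * (A₀ + constA0 κ₃ κN BG θW cΔ A₀ q.cR) * q.cR) * q.cR + A₀₂) +
        q.κB * AH₂ * (κN * θD * (constA0 κ₃ κN BG θW cΔ A₀ q.cR + A₀) * q.cR) * q.cR ≤ q.Cst)
    (hδ15 : q.δ15 ≤ δ₀) (hm : 1 ≤ q.m) (hθ : 0 ≤ q.θ) (hθM : q.θ * Mc ≤ 1) :
    ∃ D : Data190 d Mc N (fun n => TPt d (N n * Mc) → ℂ) q,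
      ∀ (n : ℕ) (X : TDom d (N n)) (x : TPt d (N n * Mc)),
        D.hn n X x = fun x' : TPt d (N n * Mc) =>
          if tcubeOf (N n) Mc x' ∈ X.1 then ((dH n (Pi.single x (1 : ℝ)) x' : ℝ) : ℂ) else 0 :=
  ⟨{ I := I, gn := fun n => toB6 (torusGeom (Nf n) (η n) (L n) (Mg n)) (R n) (H n),
     FBn := fun n => TPt d (N n * Mc) → ℝ, FAn := fun n => TPt d (N n * Mc) → ℝ,
     bBn := fun n => BlockNorm.ofBlocks (toB6 (torusGeom (Nf n) (η n) (L n) (Mg n)) (R n) (H n))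
       (fun x : TPt d (N n * Mc) => e n (tcubeOf (N n) Mc x)),
     boutn := fun n _ => BlockNorm.ofBlocks (toB6 (torusGeom (Nf n) (η n) (L n) (Mg n)) (R n) (H n))
       (fun x : TPt d (N n * Mc) => e n (tcubeOf (N n) Mc x)),
     dHn := dH, blkn := fun n X => (X.1.image (e n) : Finset (UT (Nf n))),
     ιn := fun n X A x => if tcubeOf (N n) Mc x ∈ X.1 then ((A x : ℝ) : ℂ) else 0,
     un := fun _ x => Pi.single x (1 : ℝ),
     h190 := h190_of_sectG_torusGeom
       (fun n => BlockNorm.ofBlocks (toB6 (torusGeom (Nf n) (η n) (L n) (Mg n)) (R n) (H n))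
         (fun x : TPt d (N n * Mc) => e n (tcubeOf (N n) Mc x)))
       bN b3 (fun n (_ : I) => BlockNorm.ofBlocks (toB6 (torusGeom (Nf n) (η n) (L n) (Mg n)) (R n) (H n))
         (fun x : TPt d (N n * Mc) => e n (tcubeOf (N n) Mc x)))
       Gt W D2H0 H0 Hk A0 dH Dfr M₀ hδ₀ hσ₀ hσ hcR hBG hBG₂ hθW hcΔ hA₀
       hA₀₂ hAH₂ hθD hM₀ (fun _ => hκB) hκN hκ₃ hG (fun n _ => hG₂ n) h189 hD2H0 hH0 (fun n _ => hH0₂ n)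
       (fun n _ => hH₂ n) hDfr h184 h188 h182 hq hCst hδ15,
     hdist := hdist_torusGeom Nf η L Mg R H,
     hrow := hrow_torusGeom Nf η L Mg R H hδ₀ hσ₀ hcR,
     hκB := fun _ => hκB,
     hdom := fun n => by
       -- typeclass synthesis does not unfold `toB6`: name the block torus's decidable equality on `g.Site`
       letI : DecidableEq (toB6 (torusGeom (Nf n) (η n) (L n) (Mg n)) (R n) (H n)).Site :=
         inferInstanceAs (DecidableEq (UT (Nf n)))
       exact normDominated_restrictC_ofBlocks (g := toB6 (torusGeom (Nf n) (η n) (L n) (Mg n)) (R n) (H n)) (e n) i₀,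
     hm := fun n x y' => (loc_ofBlocks_single_le_one
       (g := toB6 (torusGeom (Nf n) (η n) (L n) (Mg n)) (R n) (H n)) _ x y').trans hm,
     hD := fun n => unitFieldsLocalised_single (e n) (he n) hθ hθM }, fun _ _ _ => rfl⟩

/-- **THE SAME ON THE CUBE TORUS ITSELF (canonical identification ê, no block-index letter)**: blocks = the M-cubes of
the torus read in `Π_i Fin (N n)` through ê (an isometry, generation 93 §3), everything else — including the exposed
(4.35) computation rule — as in `exists_data190_of_sectG_blocks_supNorm`. [cite: Balaban1985Variational, (182)-(190) pp.307-308; Balaban1987RG1, (4.4) p.281 and p.282; Balaban1984PropagatorsII, (2.46) p.231, (2.61) p.234] -/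
theorem exists_data190_of_sectG_cubes_supNorm (I : Type) (i₀ : I) {η L Mg R : ℕ → ℝ} {H : ℕ → Prop}
    (bN : (n : ℕ) → BlockNorm (toB6 (torusGeom (fun _ : Fin d => N n) (η n) (L n) (Mg n)) (R n) (H n))
      (TPt d (N n * Mc) → ℝ))
    (b3 : (n : ℕ) → BlockNorm (toB6 (torusGeom (fun _ : Fin d => N n) (η n) (L n) (Mg n)) (R n) (H n)) (F3 n))
    (Gt : (n : ℕ) → F3 n →ₗ[ℝ] (TPt d (N n * Mc) → ℝ)) (W : (n : ℕ) → (TPt d (N n * Mc) → ℝ) →ₗ[ℝ] F3 n)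
    (D2H0 : (n : ℕ) → (TPt d (N n * Mc) → ℝ) →ₗ[ℝ] F3 n)
    (H0 Hk A0 dH : (n : ℕ) → (TPt d (N n * Mc) → ℝ) →ₗ[ℝ] (TPt d (N n * Mc) → ℝ))
    (Dfr : (n : ℕ) → (TPt d (N n * Mc) → ℝ) →ₗ[ℝ] (TPt d (N n * Mc) → ℝ)) (M₀ : ℕ → ℝ)
    {δ₀ BG BG₂ θW cΔ A₀ A₀₂ AH₂ θD κN κ₃ : ℝ}
    (hδ₀ : 0 < δ₀) (hσ₀ : 0 < q.σ) (hσ : q.σ ≤ δ₀ / 8) (hcR : B6.c0 δ₀ (q.σ / δ₀) ^ d ≤ q.cR)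
    (hBG : 0 ≤ BG) (hBG₂ : 0 ≤ BG₂) (hθW : 0 ≤ θW) (hcΔ : 0 ≤ cΔ) (hA₀ : 0 ≤ A₀) (hA₀₂ : 0 ≤ A₀₂)
    (hAH₂ : 0 ≤ AH₂) (hθD : 0 ≤ θD) (hM₀ : ∀ n, 0 ≤ M₀ n)
    (hκB : 1 ≤ q.κB) (hκN : ∀ n, (bN n).κ ≤ κN) (hκ₃ : ∀ n, (b3 n).κ ≤ κ₃)
    (hG : ∀ n, HasMaj (b3 n) (bN n) (Gt n)
      (fun y y' => BG * Real.exp (-(δ₀ * tdist1 (fun _ : Fin d => N n) y y'))))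
    (hG₂ : ∀ n, HasMaj (b3 n) (BlockNorm.ofBlocks (toB6 (torusGeom (fun _ : Fin d => N n) (η n) (L n) (Mg n)) (R n) (H n))
      (fun x : TPt d (N n * Mc) => fun i =>
        (⟨(tcubeOf (N n) Mc x i).val, ZMod.val_lt (tcubeOf (N n) Mc x i)⟩ : Fin (N n)))) (Gt n)
      (fun y y' => BG₂ * Real.exp (-(δ₀ * tdist1 (fun _ : Fin d => N n) y y'))))
    (h189 : ∀ n, Ineq189 (bN n) (b3 n) (W n) θW δ₀)
    (hD2H0 : ∀ n, HasMaj (BlockNorm.ofBlocks (toB6 (torusGeom (fun _ : Fin d => N n) (η n) (L n) (Mg n)) (R n) (H n))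
      (fun x : TPt d (N n * Mc) => fun i =>
        (⟨(tcubeOf (N n) Mc x i).val, ZMod.val_lt (tcubeOf (N n) Mc x i)⟩ : Fin (N n)))) (b3 n) (D2H0 n)
      (fun y y' => cΔ * Real.exp (-(δ₀ * tdist1 (fun _ : Fin d => N n) y y'))))
    (hH0 : ∀ n, HasMaj (BlockNorm.ofBlocks (toB6 (torusGeom (fun _ : Fin d => N n) (η n) (L n) (Mg n)) (R n) (H n))
      (fun x : TPt d (N n * Mc) => fun i =>
        (⟨(tcubeOf (N n) Mc x i).val, ZMod.val_lt (tcubeOf (N n) Mc x i)⟩ : Fin (N n)))) (bN n) (H0 n)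
      (fun y y' => A₀ * Real.exp (-(δ₀ * tdist1 (fun _ : Fin d => N n) y y'))))
    (hH0₂ : ∀ n, HasMaj (BlockNorm.ofBlocks (toB6 (torusGeom (fun _ : Fin d => N n) (η n) (L n) (Mg n)) (R n) (H n))
      (fun x : TPt d (N n * Mc) => fun i =>
        (⟨(tcubeOf (N n) Mc x i).val, ZMod.val_lt (tcubeOf (N n) Mc x i)⟩ : Fin (N n))))
      (BlockNorm.ofBlocks (toB6 (torusGeom (fun _ : Fin d => N n) (η n) (L n) (Mg n)) (R n) (H n))
      (fun x : TPt d (N n * Mc) => fun i =>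
        (⟨(tcubeOf (N n) Mc x i).val, ZMod.val_lt (tcubeOf (N n) Mc x i)⟩ : Fin (N n)))) (H0 n)
      (fun y y' => A₀₂ * Real.exp (-(δ₀ * tdist1 (fun _ : Fin d => N n) y y'))))
    (hH₂ : ∀ n, HasMaj (BlockNorm.ofBlocks (toB6 (torusGeom (fun _ : Fin d => N n) (η n) (L n) (Mg n)) (R n) (H n))
      (fun x : TPt d (N n * Mc) => fun i =>
        (⟨(tcubeOf (N n) Mc x i).val, ZMod.val_lt (tcubeOf (N n) Mc x i)⟩ : Fin (N n))))
      (BlockNorm.ofBlocks (toB6 (torusGeom (fun _ : Fin d => N n) (η n) (L n) (Mg n)) (R n) (H n))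
      (fun x : TPt d (N n * Mc) => fun i =>
        (⟨(tcubeOf (N n) Mc x i).val, ZMod.val_lt (tcubeOf (N n) Mc x i)⟩ : Fin (N n)))) (Hk n)
      (fun y y' => AH₂ * Real.exp (-(δ₀ / 2 * tdist1 (fun _ : Fin d => N n) y y'))))
    (hDfr : ∀ n, HasMaj (bN n) (BlockNorm.ofBlocks (toB6 (torusGeom (fun _ : Fin d => N n) (η n) (L n) (Mg n)) (R n) (H n))
      (fun x : TPt d (N n * Mc) => fun i =>
        (⟨(tcubeOf (N n) Mc x i).val, ZMod.val_lt (tcubeOf (N n) Mc x i)⟩ : Fin (N n)))) (Dfr n)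
      (fun y y' => θD * Real.exp (-(δ₀ / 2 * tdist1 (fun _ : Fin d => N n) y y'))))
    (h184 : ∀ n, Eq184 (A0 n) (H0 n) (Gt n) (W n) (D2H0 n))
    (h188 : ∀ n, Bound188 (BlockNorm.ofBlocks (toB6 (torusGeom (fun _ : Fin d => N n) (η n) (L n) (Mg n)) (R n) (H n))
      (fun x : TPt d (N n * Mc) => fun i =>
        (⟨(tcubeOf (N n) Mc x i).val, ZMod.val_lt (tcubeOf (N n) Mc x i)⟩ : Fin (N n)))) (bN n) (A0 n) (M₀ n))
    (h182 : ∀ n, Eq182 (dH n) (A0 n) (H0 n) (Hk n) (Dfr n))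
    (hq : qG κ₃ κN BG θW q.cR < 1)
    (hCst : (κ₃ * BG₂ * (cΔ + κN * θW * (A₀ + constA0 κ₃ κN BG θW cΔ A₀ q.cR) * q.cR) * q.cR + A₀₂) +
        q.κB * AH₂ * (κN * θD * (constA0 κ₃ κN BG θW cΔ A₀ q.cR + A₀) * q.cR) * q.cR ≤ q.Cst)
    (hδ15 : q.δ15 ≤ δ₀) (hm : 1 ≤ q.m) (hθ : 0 ≤ q.θ) (hθM : q.θ * Mc ≤ 1) :
    ∃ D : Data190 d Mc N (fun n => TPt d (N n * Mc) → ℂ) q,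
      ∀ (n : ℕ) (X : TDom d (N n)) (x : TPt d (N n * Mc)),
        D.hn n X x = fun x' : TPt d (N n * Mc) =>
          if tcubeOf (N n) Mc x' ∈ X.1 then ((dH n (Pi.single x (1 : ℝ)) x' : ℝ) : ℂ) else 0 :=
  exists_data190_of_sectG_blocks_supNorm (Nf := fun n (_ : Fin d) => N n) I i₀
    (fun n (a : TPt d (N n)) => fun i => (⟨(a i).val, ZMod.val_lt (a i)⟩ : Fin (N n)))
    (fun _ a b => pl1_le_tdist1_finOfVal a b) bN b3 Gt W D2H0 H0 Hk A0 dH Dfr M₀ hδ₀ hσ₀ hσ hcR hBG hBG₂ hθW hcΔ hA₀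
    hA₀₂ hAH₂ hθD hM₀ hκB hκN hκ₃ hG hG₂ h189 hD2H0 hH0 hH0₂ hH₂ hDfr h184 h188 h182 hq hCst hδ15 hm hθ hθM

end Certificate

end Literature.MathematicalPhysics.QuantumFieldTheory.Balaban1983to89.Beta.RemainderDecay190SupNorm
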